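import Summits.Schanuel.Schanuel.Theorems.RootDecomp1KXTop03
import Summits.Schanuel.Schanuel.Theorems.RootDecomp1KXAll05
import Summits.Schanuel.Schanuel.Theorems.RootDecomp1KLevelFinite11
import Summits.Schanuel.Schanuel.Theorems.RootDecomp1KLevelFinite13

/-!
# RootDecomp1KSubspaceBranch — lens 1, generation 52, node 11 «p-ADIC SUBSPACE AT THE LIVE NEAR-ROOT BRANCH — m₀ = 2 BELOW RIDOUT'S EXPONENT» (RULE K-R40 (viii)(α)) — part 1 (RootDecomp1KSubspaceBranch01): §0 the binder PadicSubspace, §1 helpers, §2 Taylor tail, §3 second-order level identity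

(lens-1 g52 node 11 HOME kernel K = HOME/decomp-schanuel-lens-1/g52/SubspaceBranch.lean a7b59aa9…, 1162 l, 79 thm + 9 def, imports tree …RootDecomp1KXTop03 + …RootDecomp1KXAll05 + …RootDecomp1KLevelFinite11 + …RootDecomp1KLevelFinite13 ONLY; Probe SubspaceBranchProbe.lean 53090850… / Ctrl0 d8674a5f… / Ctrl 041869f9…; memo NODE-g52.md 489a38e4…; SHA256SUMS; cite-kind ledger item wi-102433 (PadicSubspace → statement-only Literature fact typed to Bilu, Sém. Bourbaki 967 Thm 2.3); CLAIM L2534, crit EX-ANTE PRICE L2535 (ONE THEOREM ×1 «SUBSPACE BRANCH» under RULE K-R40 (viii)(α) iff CHECKLIST K-g52; RULE K-R41), NODE L2542 / REQUEST L2543, writer re-check L2548, critic VERDICT L2546: CLEARED — THEOREM ×1 «SUBSPACE BRANCH» under RULE K-R40 (viii)(α), CHECKLIST K-g52 met; PORT GO L2546/L2547 (A) (four parts, docstrings, private re-emissions, scoped maxHeartbeats, «(sources: …)» binder — sanctioned ex ante); RULES K-R41 / K-R42. Port by census-1 gen 22 as `RootDecomp1KSubspaceBranch01–04` (`--supports stmt-Schanuel-33364`;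 no census credit): 01 = §0 the ONE new Diophantine input typed by name **`PadicSubspace : Prop`** ([hypothesis] definition — Schlickewei's p-adic Subspace Theorem over `ℚ` at `{∞, p}`, integer points, algebraic coefficients, `ε = 1/q`; sources in the docstring; a THEOREM in print, NOT proved in the tree; NOT the tree's rational-form `Subspace*` I–VI) + §1 helpers + §2 the ultrametric Taylor tail + §3 the second-order level identity and the refined approximation `‖r − β + 2^{N!}·γ_β‖₂` at a simple root; 02 = §4 algebraicity of the correction `γ_β`, the integer vector `xvec N r = (num r, den r, 2^{N!}·den r)` and the `3 + 3` linear forms `Lform` / `Mform` (linear independence, algebraicity) + §5 the exponent inequality (`ε = 1/8`, `N₀ = N₀(C, P)`); 03 = §6 subspace-by-subspace finiteness of levels (no Diophantine input) + §7 ASSEMBLY **`thinFibreAt_xPoly_of_padicSubspace (hS : PadicSubspace) … (hsep) (hdeg) (hm : 2 ≤ m₀) (hme : e + 1 ≤ m₀) : ThinFibreAt m₀ (xPolyP k c)`** (the tree's `RootDecomp1KXTop.thinFibreAt_xPoly` with `3 ≤ m₀` replaced by `2 ≤ m₀`; the `m₀ ≥ 3` branch delegated to the tree by name); 04 = §8 intrinsic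 form + the residual of record RE-BOOKED (`SiegelShapesOffSbAt`, `ThinFibre m₀ ⟸ PadicSubspace ∧ SiegelShapesOffSbAt m₀`; bookkeeping ×0 by K-R40 (vi)) + §9 members at `m₀ = 2` (`M17P` = x²(Y²−17) + x(Y³+Y+1) + (Y³−2), `L17P` = (Y+3) + x(Y²−17), the family) and the COSTUME TEST BY NAME (`¬ DecidedAt 2 M17P` disjunct by disjunct). PORT EDITS: K's module-docstring line «Imports: tree XTop03, LevelFinite13 only» corrected to the four actual imports (writer L2548; docstring-only); 20 one-line docstrings added on undocumented computation lemmas (statements quoted); the 14 `private` helpers of K stay private (file-local copies re-emitted in later parts where used); K's five `set_option maxHeartbeats … in` kept as in K; statements and proofs otherwise VERBATIM. Rung 0 — nothing here proves Schanuel, 33364, 33363, 31077, ThinFibre 2 or SiegelShapesOffAt 2; the headline is CONDITIONAL on `PadicSubspace`.)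
-/

/-!
# RootDecomp1KSubspaceBranch — lens 1, generation 52, node 11 «p-ADIC SUBSPACE AT THE LIVE NEAR-ROOT BRANCH:
  the thin-fibre clause at quality m₀ = 2 below Ridout's exponent» (RULE K-R40 (viii)(α); CLAIM L2534)

HONEST SCOPE (line 1).  ONE theorem on the K-line's thin-fibre residual, MODULO ONE NEW DIOPHANTINE INPUT typed by
name: `thinFibreAt_xPoly_of_padicSubspace (hS : PadicSubspace) … (hm : 2 ≤ m₀) (hme : e + 1 ≤ m₀) :
ThinFibreAt m₀ (xPolyP k c)` for every `x`-degree `k ≥ 1`, every top `x`-coefficient `c_k` separable over `ℚ`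
(simple finite points over `x = ∞`) and `deg c_j ≤ deg c_k + e` — i.e. the tree's `RootDecomp1KXTop.thinFibreAt_xPoly`
(node 4, «`3 ≤ m₀`») with `3 ≤ m₀` REPLACED by `2 ≤ m₀`.  The new content is exactly `m₀ = 2`, `e ≤ 1`: the LIVE
near-root branch (top WITH simple `ℚ₂`-roots, `μ_ℚ₂ = 1`, `2 ≤ m₀ < max(3, 2μ+1) = 3`) where one-form Ridout is short
(the clause needs `den ≳ 2^{N!(1+1/N)/2}`, Ridout only excludes `den ≲ 2^{N!/(2+δ)}`).  NO ∀-item moves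
(33364 / 33363 / 31077 / `Schanuel` UNMOVED); `ThinFibre 2` is NOT proved; tops with a MULTIPLE `ℚ₂`-root at
`m₀ < 2μ+1` and the order `e ≥ m₀` at `(∞, ∞)` stay open; rung count 0.

THE INPUT.  `PadicSubspace` = Schlickewei's p-adic Subspace Theorem over `ℚ` at the two places `{∞, p}`, integer
points, algebraic coefficients, `ε = 1/q` (sources: Schlickewei, J. reine angew. Math. 288 (1976) 86–105 and Arch.
Math. 29 (1977) 267–270; Bilu, Séminaire Bourbaki exp. 967 (2006/07) Thm 2.3; Bombieri–Gubler, Heights in Diophantine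
Geometry (2006) Thm 7.2.2 + Rem 7.2.3 + Cor 7.2.5; Evertse–Győry, Unit Equations in Diophantine Number Theory (2015)
Thm 3.1.3).  It is a HYPOTHESIS here — a theorem in print, NOT proved in the tree: the tree's Subspace programme
`Literature/NumberTheory/DiophantineApproximation/Subspace*.lean` (I–VI) and the written-out `hST` of
`Literature.NumberTheory.DiophantineGeometry.BugeaudCorvajaZannier2003_thm1_of_subspaceTheorem` are RATIONAL-FORM
statements, which cannot see an irrational 2-adic algebraic `β`.  So the residual of record is RE-BOOKED, not
discharged: `SiegelShapesOffAt 2 ⟸ PadicSubspace ∧ SiegelShapesOffSbAt 2` (§8, bookkeeping, ×0 by K-R40 (vi)).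

MECHANISM.  (§3) second-order level identity `‖c_k(r) + 2^{N!}·c_{k−1}(r)‖₂ ≤ M·2^{−N!−E}`, `E = N! − (N−1)!`
(`p_N ≡ 1 mod 2^E`, tree `norm_psNumer_sub_one`); (§2) ultrametric Taylor tail at the simple root `β`:
`‖r − β + 2^{N!}·γ_β‖₂ ≤ K·2^{−2N!+(N−1)!}` with `γ_β := c_{k−1}(β)/c_k′(β) ∈ ℚ(β)` algebraic and in general
IRRATIONAL; (§4–§6) the integer vector `x = (num r, den r, 2^{N!}·den r)`: real coordinate forms `∏ ≤ C·2^{N!}·d³`,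
2-adic forms `(X₀ − βX₁ + γ_βX₂, X₁, X₂)` `∏ ≤ K·2^{−3N!+(N−1)!}`; if the `m₀ = 2` clause FAILS
(`d^{2N} ≤ C·2^{(N+1)!}`) the Subspace inequality with `ε = 1/8` holds for `N ≥ N₀`; (§5) each of the finitely many
rational subspaces carries finitely many LEVELS (no Diophantine input); (§7) assembly with the tree's dichotomy
`near_root_or_at_infinity`, `infinity_arith` (`e + 1 ≤ 2`), `levels_finite_of_nondeg`.

Imports: tree `RootDecomp1KXTop03`, `RootDecomp1KXAll05`, `RootDecomp1KLevelFinite11`, `RootDecomp1KLevelFinite13` only.  0 sorry;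
standard axioms.
-/

noncomputable section

namespace Summit.Schanuel.Schanuel.Theorems.RootDecomp1KSubspaceBranch

open Polynomial LiouvilleNumber
open scoped Nat
open Summit.Schanuel.Schanuel.Theorems.RootDecomp1KSkelCell (SkelLiouvilleFix)
open Summit.Schanuel.Schanuel.Theorems.RootDecomp1KTwoBaseCell (psNumer partialSum_eq_psNumer_div)
open Summit.Schanuel.Schanuel.Theorems.RootDecomp1KRelLiouvilleCell (partialSum_two_strictMono)
open Summit.Schanuel.Schanuel.Theorems.RootDecomp1KDegreeLadder
open Summit.Schanuel.Schanuel.Theorems.RootDecomp1KXLinearCore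
open Summit.Schanuel.Schanuel.Theorems.RootDecomp1KXLinear
open Summit.Schanuel.Schanuel.Theorems.RootDecomp1KXLinearII
open Summit.Schanuel.Schanuel.Theorems.RootDecomp1KXTop
open Summit.Schanuel.Schanuel.Theorems.RootDecomp1KXAll
open Summit.Schanuel.Schanuel.Theorems.RootDecomp1KLevelFinite

/-! ### §0  The one new Diophantine input, typed by name -/

/-- [residual hypothesis — a THEOREM in print, NOT proved in the tree; typed to Bilu's shape] **Schlickewei's p-adic
Subspace Theorem over `ℚ` at the places `{∞, p}`, integer points, algebraic coefficients, `ε = 1/q`.**  For `n ≥ 2`,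
a prime `p`, `n` linearly independent real linear forms `L_i` with real algebraic coefficients and `n` linearly
independent `p`-adic linear forms `M_i` with algebraic coefficients in `ℂ_p`, and `q ≥ 1`: the integer points
`x ≠ 0` with `((∏_i |L_i(x)|)·(∏_i ‖M_i(x)‖_p))^q · ‖x‖_sup < 1` (that is `∏∏ < ‖x‖_sup^{−1/q}`) lie in finitely
many proper rational subspaces (sources: Schlickewei, J. reine angew. Math. 288 (1976) 86–105; Arch. Math. 29 (1977)
267–270; Bilu, Sém. Bourbaki 967 Thm 2.3; Bombieri–Gubler 2006 Thm 7.2.2, Rem 7.2.3, Cor 7.2.5; Evertse–Győry 2015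
Thm 3.1.3; ledger cite work item wi-102433; the tree's rational-coefficient instance is the hypothesis `hST` of
`Literature.NumberTheory.DiophantineGeometry.BugeaudCorvajaZannier2003_thm1_of_subspaceTheorem`, which cannot host
forms with irrational algebraic `p`-adic coefficients). -/
def PadicSubspace : Prop :=
  ∀ (n : ℕ), 2 ≤ n → ∀ (p : ℕ) [Fact p.Prime] (L : Fin n → Fin n → ℝ) (M : Fin n → Fin n → PadicAlgCl p),
    (∀ i j, IsAlgebraic ℚ (L i j)) → (∀ i j, IsAlgebraic ℚ (M i j)) →
    LinearIndependent ℝ L → LinearIndependent (PadicAlgCl p) M →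
    ∀ q : ℕ, 1 ≤ q →
      ∃ T : Finset (Fin n → ℚ), (∀ f ∈ T, f ≠ 0) ∧
        ∀ x : Fin n → ℤ, x ≠ 0 →
          ((∏ i, |∑ j, L i j * (x j : ℝ)|) * (∏ i, ‖∑ j, M i j * (x j : PadicAlgCl p)‖)) ^ q *
              ((Finset.univ.sup fun j => (x j).natAbs : ℕ) : ℝ) < 1 →
            ∃ f ∈ T, ∑ j, f j * (x j : ℚ) = 0

/-! ### §1  Small helpers (private copies of tree one-liners) -/

/-- `s_N = p_N / 2^{N!}`. -/
private theorem partialSum_two (N : ℕ) : partialSum 2 N = (psNumer 2 N : ℝ) / (2 : ℝ) ^ N ! := by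
  have := partialSum_eq_psNumer_div (b := 2) (by norm_num) N
  simpa using this

/-- `‖2‖₂ = 1/2` in `ℂ₂`. -/
private theorem norm_two : ‖(2 : PadicAlgCl 2)‖ = 1 / 2 := by
  have h1 : ((2 : ℕ) : PadicAlgCl 2) = algebraMap ℚ_[2] (PadicAlgCl 2) ((2 : ℕ) : ℚ_[2]) :=
    (map_natCast _ 2).symm
  have h2 : ‖((2 : ℕ) : ℚ_[2])‖ = (↑(2 : ℕ) : ℝ)⁻¹ := Padic.norm_p
  have h3 : ‖((2 : ℕ) : PadicAlgCl 2)‖ = 1 / 2 := by rw [h1, PadicAlgCl.norm_extends, h2]; norm_num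
  simpa using h3

/-- `‖2^t‖₂ = 2^{−t}`. -/
private theorem norm_two_pow (t : ℕ) : ‖(2 : PadicAlgCl 2) ^ t‖ = (1 / 2 : ℝ) ^ t := by
  rw [norm_pow, norm_two]

/-- `‖z‖₂ ≤ 1` for integers. -/
private theorem norm_intCast_le_one' (z : ℤ) : ‖(z : PadicAlgCl 2)‖ ≤ 1 := by
  have h1 : (z : PadicAlgCl 2) = algebraMap ℚ_[2] (PadicAlgCl 2) (z : ℚ_[2]) := (map_intCast _ z).symm
  rw [h1, PadicAlgCl.norm_extends]
  exact Padic.norm_int_le_one z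

/-- `‖n‖₂ ≤ 1` for naturals. -/
private theorem norm_natCast_le_one' (n : ℕ) : ‖(n : PadicAlgCl 2)‖ ≤ 1 := by
  have := norm_intCast_le_one' (n : ℤ)
  simpa using this

/-- a polynomial separable over `ℚ` is non-zero. -/
private theorem ne_zero_of_map_separable' {B : ℤ[X]} (hsep : (B.map (Int.castRingHom ℚ)).Separable) : B ≠ 0 := by
  rintro rfl
  rw [Polynomial.map_zero] at hsep
  exact not_separable_zero hsep

/-! ### §2  The ultrametric Taylor tail -/

/-- Hasse derivatives commute with the coefficient map `ℤ → ℂ₂`. -/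
theorem hasseDeriv_map_intCast (A : ℤ[X]) (i : ℕ) :
    hasseDeriv i (A.map (Int.castRingHom (PadicAlgCl 2))) = (hasseDeriv i A).map (Int.castRingHom (PadicAlgCl 2)) := by
  ext n
  simp [hasseDeriv_coeff, coeff_map]

/-- the Taylor coefficients of an integer polynomial at `β`: `(taylor β Ā).coeff i = (hasseDeriv i A)(β)`. -/
theorem taylor_coeff_eq (A : ℤ[X]) (β : PadicAlgCl 2) (i : ℕ) :
    (taylor β (A.map (Int.castRingHom (PadicAlgCl 2)))).coeff i = aeval β (hasseDeriv i A) := by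
  rw [taylor_coeff, hasseDeriv_map_intCast, eval_map, aeval_def]
  congr 1

/-- each Taylor coefficient is bounded: `‖(hasseDeriv i A)(β)‖ ≤ max(1, ‖β‖)^{deg A}`. -/
theorem norm_aeval_hasseDeriv_le (A : ℤ[X]) (β : PadicAlgCl 2) (i : ℕ) :
    ‖aeval β (hasseDeriv i A)‖ ≤ max 1 ‖β‖ ^ A.natDegree := by
  refine (norm_aeval_le (hasseDeriv i A) β).trans ?_
  exact pow_le_pow_right₀ (le_max_left _ _) ((natDegree_hasseDeriv_le A i).trans (Nat.sub_le _ _))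

/-- **THE ULTRAMETRIC TAYLOR TAIL.**  For `A ∈ ℤ[Y]`, `β, z ∈ ℂ₂` with `‖z − β‖₂ ≤ 1` and any order `n`:
`‖A(z) − Σ_{i<n} (hasseDeriv i A)(β)·(z − β)^i‖₂ ≤ max(1, ‖β‖₂)^{deg A} · ‖z − β‖₂^n`. -/
theorem norm_taylor_tail (A : ℤ[X]) (β z : PadicAlgCl 2) (hz : ‖z - β‖ ≤ 1) (n : ℕ) :
    ‖aeval z A - ∑ i ∈ Finset.range n, aeval β (hasseDeriv i A) * (z - β) ^ i‖ ≤
      max 1 ‖β‖ ^ A.natDegree * ‖z - β‖ ^ n := by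
  classical
  set Abar : (PadicAlgCl 2)[X] := A.map (Int.castRingHom (PadicAlgCl 2)) with hAbar
  set K : ℕ := max (A.natDegree + 1) n with hK
  have hdegT : (taylor β Abar).natDegree < K := by
    rw [natDegree_taylor]
    exact lt_of_le_of_lt natDegree_map_le (lt_of_lt_of_le (Nat.lt_succ_self _) (le_max_left _ _))
  have heval : aeval z A = ∑ i ∈ Finset.range K, aeval β (hasseDeriv i A) * (z - β) ^ i := by
    have h1 : aeval z A = (taylor β Abar).eval (z - β) := by
      rw [taylor_eval, sub_add_cancel, hAbar, eval_map, aeval_def]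
      congr 1
    rw [h1, eval_eq_sum_range' hdegT]
    refine Finset.sum_congr rfl fun i _ => ?_
    rw [taylor_coeff_eq]
  have hsub : Finset.range n ⊆ Finset.range K := Finset.range_subset_range.mpr (le_max_right _ _)
  rw [heval, ← Finset.sum_sdiff hsub, add_sub_cancel_right]
  have hM1 : 1 ≤ max 1 ‖β‖ := le_max_left _ _
  apply IsUltrametricDist.norm_sum_le_of_forall_le_of_nonneg (by positivity)
  intro i hi
  have hin : n ≤ i := by
    have := (Finset.mem_sdiff.mp hi).2
    rw [Finset.mem_range, not_lt] at this
    exact this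
  rw [norm_mul, norm_pow]
  exact mul_le_mul (norm_aeval_hasseDeriv_le A β i) (pow_le_pow_of_le_one (norm_nonneg _) hz hin)
    (by positivity) (by positivity)

/-- order `1`: `‖A(z) − A(β)‖₂ ≤ max(1,‖β‖₂)^{deg A}·‖z − β‖₂`. -/
theorem norm_sub_aeval_le (A : ℤ[X]) (β z : PadicAlgCl 2) (hz : ‖z - β‖ ≤ 1) :
    ‖aeval z A - aeval β A‖ ≤ max 1 ‖β‖ ^ A.natDegree * ‖z - β‖ := by
  have h := norm_taylor_tail A β z hz 1
  simpa [hasseDeriv_zero] using h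

/-- order `2`: `‖A(z) − A(β) − A′(β)(z − β)‖₂ ≤ max(1,‖β‖₂)^{deg A}·‖z − β‖₂²`. -/
theorem norm_sub_taylor_two_le (A : ℤ[X]) (β z : PadicAlgCl 2) (hz : ‖z - β‖ ≤ 1) :
    ‖aeval z A - aeval β A - aeval β (derivative A) * (z - β)‖ ≤ max 1 ‖β‖ ^ A.natDegree * ‖z - β‖ ^ 2 := by
  have h := norm_taylor_tail A β z hz 2
  simpa [Finset.sum_range_succ, hasseDeriv_zero, hasseDeriv_one, sub_sub] using h

/-! ### §3  The second-order level identity and the refined approximation at a simple root -/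

/-- ultrametric bookkeeping: `‖a − b‖ ≤ B` from `‖a‖, ‖b‖ ≤ B`. -/
private theorem norm_sub_le_of_le {a b : PadicAlgCl 2} {B : ℝ} (ha : ‖a‖ ≤ B) (hb : ‖b‖ ≤ B) : ‖a - b‖ ≤ B := by
  rw [sub_eq_add_neg]
  refine (IsUltrametricDist.norm_add_le_max _ _).trans (max_le ha ?_)
  rwa [norm_neg]

/-- ultrametric bookkeeping: `‖a + b‖ ≤ B` from `‖a‖, ‖b‖ ≤ B`. -/
private theorem norm_add_le_of_le {a b : PadicAlgCl 2} {B : ℝ} (ha : ‖a‖ ≤ B) (hb : ‖b‖ ≤ B) : ‖a + b‖ ≤ B :=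
  (IsUltrametricDist.norm_add_le_max _ _).trans (max_le ha hb)

/-- `(1/2)^{2N!} ≤ (1/2)^{N!}·(1/2)^{N! − (N−1)!}`. -/
private theorem half_pow_two_mul_le (N : ℕ) :
    (1 / 2 : ℝ) ^ (2 * N !) ≤ (1 / 2 : ℝ) ^ N ! * (1 / 2 : ℝ) ^ (Nat.factorial N - Nat.factorial (N - 1)) := by
  rw [two_mul, pow_add]
  exact mul_le_mul_of_nonneg_left (pow_le_pow_of_le_one (by norm_num) (by norm_num) (Nat.sub_le _ _))
    (by positivity)

set_option maxHeartbeats 400000 in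
/-- **THE SECOND-ORDER LEVEL IDENTITY** (`k ≥ 1`, `N ≥ 3`): on the level `x = s_N`,
`‖c_k(r) + 2^{N!}·c_{k−1}(r)‖₂ ≤ 2^{−N!}·2^{−(N! − (N−1)!)}·max(1, ‖r‖₂)^{deg c_k + e}`.
(The level identity with the top TWO `x`-powers isolated: the lower powers contribute `O(2^{−2N!})`, and
`p_N ≡ 1 (mod 2^{N! − (N−1)!})` — tree `norm_psNumer_sub_one` — turns `p_N·c_k(r)` into `c_k(r)`.) -/
theorem second_order_level (k : ℕ) (hk : 1 ≤ k) (c : ℕ → ℤ[X]) (e : ℕ)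
    (hdeg : ∀ j, j < k → (c j).natDegree ≤ (c k).natDegree + e) {N : ℕ} (hN : 3 ≤ N) (r : ℚ)
    (hP : bev (xPolyP k c) (partialSum 2 N) r = 0) :
    ‖aeval (r : PadicAlgCl 2) (c k) + 2 ^ N ! * aeval (r : PadicAlgCl 2) (c (k - 1))‖ ≤
      ((1 / 2 : ℝ) ^ N ! * (1 / 2 : ℝ) ^ (Nat.factorial N - Nat.factorial (N - 1))) * max 1 ‖(r : PadicAlgCl 2)‖ ^ ((c k).natDegree + e) := by
  obtain ⟨k', rfl⟩ : ∃ k', k = k' + 1 := ⟨k - 1, by omega⟩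
  rw [Nat.add_sub_cancel]
  have htop := level_identity (k' + 1) c N r hP
  have hp1 : ‖(psNumer 2 N : PadicAlgCl 2)‖ = 1 := norm_psNumer hN
  set p : PadicAlgCl 2 := (psNumer 2 N : PadicAlgCl 2) with hpdef
  set M : ℝ := max 1 ‖(r : PadicAlgCl 2)‖ with hMdef
  have hM1 : 1 ≤ M := le_max_left _ _
  set D : ℕ := (c (k' + 1)).natDegree with hDdef
  set θ : ℝ := (1 / 2 : ℝ) ^ N ! * (1 / 2 : ℝ) ^ (Nat.factorial N - Nat.factorial (N - 1)) with hθ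
  have hθnn : 0 ≤ θ := by positivity
  -- Claim A: `‖p·c_k(r) + 2^{N!}·c_{k−1}(r)‖ ≤ 2^{−2N!}·M^{D+e}`
  have hA : ‖p * aeval (r : PadicAlgCl 2) (c (k' + 1)) + 2 ^ N ! * aeval (r : PadicAlgCl 2) (c k')‖ ≤
      (1 / 2 : ℝ) ^ (2 * N !) * M ^ (D + e) := by
    have hsplit : p ^ (k' + 1) * aeval (r : PadicAlgCl 2) (c (k' + 1)) +
        p ^ k' * 2 ^ N ! * aeval (r : PadicAlgCl 2) (c k') =
        -(∑ j ∈ Finset.range k', p ^ j * 2 ^ ((k' + 1 - j) * N !) * aeval (r : PadicAlgCl 2) (c j)) := by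
      rw [htop, Finset.sum_range_succ, Nat.add_sub_cancel_left, one_mul, neg_add]
      ring
    have hfac : p ^ (k' + 1) * aeval (r : PadicAlgCl 2) (c (k' + 1)) + p ^ k' * 2 ^ N ! * aeval (r : PadicAlgCl 2) (c k') =
        p ^ k' * (p * aeval (r : PadicAlgCl 2) (c (k' + 1)) + 2 ^ N ! * aeval (r : PadicAlgCl 2) (c k')) := by ring
    have hnorm : ‖p ^ k' * (p * aeval (r : PadicAlgCl 2) (c (k' + 1)) + 2 ^ N ! * aeval (r : PadicAlgCl 2) (c k'))‖ =
        ‖p * aeval (r : PadicAlgCl 2) (c (k' + 1)) + 2 ^ N ! * aeval (r : PadicAlgCl 2) (c k')‖ := by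
      rw [norm_mul, norm_pow, hp1, one_pow, one_mul]
    rw [← hnorm, ← hfac, hsplit, norm_neg]
    apply IsUltrametricDist.norm_sum_le_of_forall_le_of_nonneg (by positivity)
    intro j hj
    have hjk : j < k' := Finset.mem_range.mp hj
    rw [norm_mul, norm_mul, norm_pow, hp1, one_pow, one_mul, norm_two_pow]
    have hcj : ‖aeval (r : PadicAlgCl 2) (c j)‖ ≤ M ^ (D + e) :=
      (norm_aeval_le (c j) _).trans (pow_le_pow_right₀ hM1 (hdeg j (by omega)))
    have h2 : (1 / 2 : ℝ) ^ ((k' + 1 - j) * N !) ≤ (1 / 2 : ℝ) ^ (2 * N !) :=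
      pow_le_pow_of_le_one (by norm_num) (by norm_num) (Nat.mul_le_mul_right _ (by omega))
    exact mul_le_mul h2 hcj (norm_nonneg _) (by positivity)
  -- Claim B: `‖(p − 1)·c_k(r)‖ ≤ 2^{−E}·2^{−N!}·M^{D+e}`
  have hB : ‖(p - 1) * aeval (r : PadicAlgCl 2) (c (k' + 1))‖ ≤ θ * M ^ (D + e) := by
    have h1 := norm_psNumer_sub_one (N := N) (by omega)
    have h2 := top_coeff_small (k' + 1) c e hdeg hN r hP
    rw [norm_mul, hθ]
    calc ‖p - 1‖ * ‖aeval (r : PadicAlgCl 2) (c (k' + 1))‖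
        ≤ (1 / 2 : ℝ) ^ (Nat.factorial N - Nat.factorial (N - 1)) * ((1 / 2 : ℝ) ^ N ! * M ^ (D + e)) :=
          mul_le_mul h1 h2 (norm_nonneg _) (by positivity)
      _ = (1 / 2 : ℝ) ^ N ! * (1 / 2 : ℝ) ^ (Nat.factorial N - Nat.factorial (N - 1)) * M ^ (D + e) := by ring
  have hA' : ‖p * aeval (r : PadicAlgCl 2) (c (k' + 1)) + 2 ^ N ! * aeval (r : PadicAlgCl 2) (c k')‖ ≤ θ * M ^ (D + e) :=
    hA.trans (mul_le_mul_of_nonneg_right (half_pow_two_mul_le N) (by positivity))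
  have hid : aeval (r : PadicAlgCl 2) (c (k' + 1)) + 2 ^ N ! * aeval (r : PadicAlgCl 2) (c k') =
      (p * aeval (r : PadicAlgCl 2) (c (k' + 1)) + 2 ^ N ! * aeval (r : PadicAlgCl 2) (c k')) -
        (p - 1) * aeval (r : PadicAlgCl 2) (c (k' + 1)) := by ring
  rw [hid]
  exact norm_sub_le_of_le hA' hB

/-- in the near branch `‖r − β‖₂ ≤ 1` one has `max(1, ‖r‖₂) ≤ max(1, ‖β‖₂)`. -/
theorem max_norm_le_of_near {z β : PadicAlgCl 2} (h : ‖z - β‖ ≤ 1) : max 1 ‖z‖ ≤ max 1 ‖β‖ := by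
  refine max_le (le_max_left _ _) ?_
  have : z = β + (z - β) := by ring
  rw [this]
  refine (IsUltrametricDist.norm_add_le_max _ _).trans (max_le (le_max_right _ _) (h.trans (le_max_left _ _)))

set_option maxHeartbeats 800000 in
/-- **THE REFINED APPROXIMATION AT A SIMPLE ROOT.**  Let `β ∈ ℂ₂` be a simple root of the top `x`-coefficient
`c_k` (`k ≥ 1`).  There is `K = K(P, β, K₀) > 0` such that for every level `N ≥ 3` and every point `r` of level
`N` with `‖r − β‖₂ ≤ K₀·2^{−N!}` (and `≤ 1`):
`‖(r − β) + 2^{N!}·γ_β‖₂ ≤ K·2^{−N!}·2^{−(N! − (N−1)!)}`, `γ_β := c_{k−1}(β)/c_k′(β)`.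
So `r` approximates the MOVING algebraic target `β − 2^{N!}γ_β` to order `2^{−2N!+(N−1)!}` — twice the order at which
it approximates `β` itself; `γ_β` is algebraic and in general irrational (one-form Ridout cannot use this). -/
theorem refined_approx (k : ℕ) (hk : 1 ≤ k) (c : ℕ → ℤ[X]) (e : ℕ)
    (hdeg : ∀ j, j < k → (c j).natDegree ≤ (c k).natDegree + e)
    (β : PadicAlgCl 2) (hβ : aeval β (c k) = 0) (ht : aeval β (derivative (c k)) ≠ 0)
    (K₀ : ℝ) (hK₀ : 1 ≤ K₀) :
    ∃ K : ℝ, 0 < K ∧ ∀ N, 3 ≤ N → ∀ r : ℚ, bev (xPolyP k c) (partialSum 2 N) r = 0 →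
      ‖(r : PadicAlgCl 2) - β‖ ≤ K₀ * (1 / 2 : ℝ) ^ N ! → ‖(r : PadicAlgCl 2) - β‖ ≤ 1 →
      ‖((r : PadicAlgCl 2) - β) + 2 ^ N ! * (aeval β (c (k - 1)) / aeval β (derivative (c k)))‖ ≤
        K * ((1 / 2 : ℝ) ^ N ! * (1 / 2 : ℝ) ^ (Nat.factorial N - Nat.factorial (N - 1))) := by
  set D : ℕ := (c k).natDegree with hDdef
  set Mβ : ℝ := max 1 ‖β‖ with hMβ
  have hMβ1 : 1 ≤ Mβ := le_max_left _ _
  set t₁ : PadicAlgCl 2 := aeval β (derivative (c k)) with ht₁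
  set g : PadicAlgCl 2 := aeval β (c (k - 1)) with hg
  have htpos : 0 < ‖t₁‖ := norm_pos_iff.mpr ht
  refine ⟨Mβ ^ (D + e) * K₀ ^ 2 / ‖t₁‖, by positivity, fun N hN r hP hδ hδ1 => ?_⟩
  set z : PadicAlgCl 2 := (r : PadicAlgCl 2) with hz
  set θ : ℝ := (1 / 2 : ℝ) ^ N ! * (1 / 2 : ℝ) ^ (Nat.factorial N - Nat.factorial (N - 1)) with hθ
  have hθnn : 0 ≤ θ := by positivity
  have hhalfN : (0 : ℝ) ≤ (1 / 2 : ℝ) ^ N ! := by positivity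
  have hK₀sq : K₀ ≤ K₀ ^ 2 := by nlinarith
  have hK₀sq1 : 1 ≤ K₀ ^ 2 := hK₀.trans hK₀sq
  have hMr : max 1 ‖z‖ ≤ Mβ := max_norm_le_of_near hδ1
  set B : ℝ := Mβ ^ (D + e) * K₀ ^ 2 * θ with hBdef
  -- (1) the second-order level identity, in terms of `Mβ`
  have h1 : ‖aeval z (c k) + 2 ^ N ! * aeval z (c (k - 1))‖ ≤ B := by
    have h := second_order_level k hk c e hdeg hN r hP
    refine h.trans ?_
    rw [hBdef, ← hθ]
    calc θ * max 1 ‖z‖ ^ (D + e) ≤ θ * Mβ ^ (D + e) :=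
          mul_le_mul_of_nonneg_left (pow_le_pow_left₀ (by positivity) hMr _) hθnn
      _ = Mβ ^ (D + e) * 1 * θ := by ring
      _ ≤ Mβ ^ (D + e) * K₀ ^ 2 * θ := by gcongr
  -- (2) the Taylor remainders
  have hpowδ2 : ‖z - β‖ ^ 2 ≤ K₀ ^ 2 * ((1 / 2 : ℝ) ^ N ! * (1 / 2 : ℝ) ^ N !) := by
    calc ‖z - β‖ ^ 2 ≤ (K₀ * (1 / 2 : ℝ) ^ N !) ^ 2 := pow_le_pow_left₀ (norm_nonneg _) hδ 2
      _ = K₀ ^ 2 * ((1 / 2 : ℝ) ^ N ! * (1 / 2 : ℝ) ^ N !) := by ring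
  have h22 : (1 / 2 : ℝ) ^ N ! * (1 / 2 : ℝ) ^ N ! ≤ θ := by
    have := half_pow_two_mul_le N
    rwa [two_mul, pow_add] at this
  have h2 : ‖aeval z (c k) - t₁ * (z - β)‖ ≤ B := by
    have h := norm_sub_taylor_two_le (c k) β z hδ1
    rw [hβ, sub_zero] at h
    refine h.trans ?_
    calc max 1 ‖β‖ ^ (c k).natDegree * ‖z - β‖ ^ 2
        ≤ Mβ ^ (D + e) * (K₀ ^ 2 * ((1 / 2 : ℝ) ^ N ! * (1 / 2 : ℝ) ^ N !)) :=
          mul_le_mul (pow_le_pow_right₀ hMβ1 (by omega)) hpowδ2 (by positivity) (by positivity)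
      _ ≤ Mβ ^ (D + e) * (K₀ ^ 2 * θ) := by gcongr
      _ = B := by rw [hBdef]; ring
  have h3 : ‖2 ^ N ! * (aeval z (c (k - 1)) - g)‖ ≤ B := by
    have h := norm_sub_aeval_le (c (k - 1)) β z hδ1
    have hdk : (c (k - 1)).natDegree ≤ D + e := hdeg (k - 1) (by omega)
    rw [norm_mul, norm_two_pow]
    calc (1 / 2 : ℝ) ^ N ! * ‖aeval z (c (k - 1)) - aeval β (c (k - 1))‖
        ≤ (1 / 2 : ℝ) ^ N ! * (Mβ ^ (D + e) * (K₀ * (1 / 2 : ℝ) ^ N !)) := by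
          refine mul_le_mul_of_nonneg_left (h.trans ?_) hhalfN
          exact mul_le_mul (pow_le_pow_right₀ hMβ1 hdk) hδ (norm_nonneg _) (by positivity)
      _ = Mβ ^ (D + e) * K₀ * ((1 / 2 : ℝ) ^ N ! * (1 / 2 : ℝ) ^ N !) := by ring
      _ ≤ Mβ ^ (D + e) * K₀ ^ 2 * θ := by gcongr
      _ = B := by rw [hBdef]
  -- (3) combine: `t₁(z − β) + 2^{N!} g = (1) − (2) − (3)`
  have hid : t₁ * (z - β) + 2 ^ N ! * g =
      (aeval z (c k) + 2 ^ N ! * aeval z (c (k - 1))) - (aeval z (c k) - t₁ * (z - β)) -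
        2 ^ N ! * (aeval z (c (k - 1)) - g) := by ring
  have h4 : ‖t₁ * (z - β) + 2 ^ N ! * g‖ ≤ B := by
    rw [hid]
    exact norm_sub_le_of_le (norm_sub_le_of_le h1 h2) h3
  -- (4) divide by `t₁`
  have hid2 : (z - β) + 2 ^ N ! * (g / t₁) = t₁⁻¹ * (t₁ * (z - β) + 2 ^ N ! * g) := by
    field_simp
  rw [hid2, norm_mul, norm_inv]
  calc ‖t₁‖⁻¹ * ‖t₁ * (z - β) + 2 ^ N ! * g‖ ≤ ‖t₁‖⁻¹ * B := by gcongr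
    _ = Mβ ^ (D + e) * K₀ ^ 2 / ‖t₁‖ * θ := by rw [hBdef]; field_simp

end Summit.Schanuel.Schanuel.Theorems.RootDecomp1KSubspaceBranch

end
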